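import Literature.NumberTheory.Rogawski1990.Ch12Sec5Inputs                 -- ★ TR carpet: `EllipticData`, `InnerHDefined`, `packetCharH`, the (M1H) socket `PacketCharHRegularity`
import HarnessLib

/-!
# F0 · P3c · line LH6 «StCharTS» — «DEF-H GLUE★» (datum road S12a, hypothesis form): the socket (DEF-H) «the integrals `⟨χ_ρ, χ_ρ⟩_{H,e}` EXIST for
# every square-integrable packet `ρ ∈ Π²(H)`» — from a Harish-Chandra-type bound for `D_H·χ_ρ` on the elliptic Cartan representatives of `H`, at any datum whose
# `H`-representatives are COMPACT of FINITE mass [Rogawski1990, §12.5 Prop. 12.5.2 p. 184; §1.6 p. 5]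

Cell `pub/hodgecm-mathlib`, crux H413 = `stmt-HodgeConjecture-24833` (lane `--supports … --as helper`), route HCCMUnconditional; seat LH4-p02 (g6) (released from line LH4,
dealt on the LH6 (S-𝔇) DATUM ROAD by the map owner LH6-p01 (g4), SLICE WORD (4) 2026-09-02T11:49:03Z; map `F0/P3b/LH6-p01/g4/MAP-DATUM-ROAD.v3.LH6p01g4.md`, PLAN
`…/PLAN-S9-CartanWeylMeasures.v1.LH6p01g4.md`).  THEOREMS ONLY (no definition ∕ instance ∕ notation ∕ named fact ∕ `sorry`); ★-only imports; GENERIC over the carriers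
`G ⊇ H` of ★ `Ch12Sec5.EllipticData` (the conjunct is purely `H`-side, so no CM field or place is needed — the constructor instantiates `G := Gqs L v`, `H := HLoc L v`).
HONEST LABEL: HC_CM is proved only modulo the 7 printed citations (2 remaining named inputs: hLiu418 = `stmt-HodgeConjecture-24832`, h413 = `stmt-HodgeConjecture-24833`)
until rung 0 closes; this file closes no organ — at the future concrete datum the socket (DEF-H) of the (S-𝔇) organ `stub_EllipticPackage` (leaf
`Cruxes/H413/Lines/F0_P3c_StCharTSPaydown.lean` ED. 17, the conjunct `∀ ρ ∈ 𝔇.sqPacketsH, 𝔇.InnerHDefined (𝔇.packetCharH ρ) (𝔇.packetCharH ρ)`) becomes a theorem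
MODULO Harish-Chandra's local boundedness of the normalised characters of `H = U(Φ₂) × U(Φ₁)` (the `hHBH` hypothesis below, HC-B on `H`) — count-neutral.

THE MATHEMATICS ([Rogawski1990, §12.5 p. 184]: «Define `⟨α₁, α₂⟩_{H,e}` similarly» — the integrals `Σ_T |Ω(T,H)|⁻¹ ∫_{Z∖T} D_H(γ)² α₁(γ) \overline{α₂(γ)} dγ` over
the elliptic Cartan representatives of `H`, written without a convergence remark; Prop. 12.5.2 is stated in the tree under the antecedent ★ `InnerHDefined`).  Let `𝔇` be a
§12.5 datum.  ★ `EllipticData.InnerHDefined α₁ α₂` says: on every representative `T ∈ 𝔇.cartanH` the integrand `t ↦ D_H(t)²·α₁(t)·\overline{α₂(t)}` is `𝔇.μTH T`-integrable.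
At `α₁ = α₂ = χ_ρ` the integrand is `D_H² χ_ρ χ̄_ρ = |D_H χ_ρ|²` (as `D_H` is real), of norm `‖D_H χ_ρ‖²`.  SLICE HYPOTHESES (the `H`-side twins of PLAN S9 §1 D3 «elliptic =
compact», D4 «finite (mass-one) `dγ`», and of the (F-b)∕HC-B bound in compact-set shape): every `T ∈ cartanH` is COMPACT in `H`, `μTH T` is FINITE, `𝔇.DH` is measurable,
and for every `ρ ∈ Π²(H)`, every `T ∈ cartanH` and every compact `C ⊆ T` there is `B` with `‖D_H(γ)·χ_ρ(γ)‖ ≤ B` on `C` (Harish-Chandra [§1.6 p. 5] for `H`; the SAME shape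
as the S13a hypothesis `hHB` of ★ `F0P3cStCharTSU2Of1251` on the representatives `cartanHG`, here without Weyl conjugates).  Measurability of `χ_ρ` is READ from the
organ's own (M1H) socket ★ `EllipticData.PacketCharHRegularity` (first conjunct).  Then `|D_H χ_ρ|²` is a bounded measurable function on a finite measure space, hence
integrable (Mathlib `Integrable.mono'` against the constant `B²`) — for EVERY `ρ ∈ Π²(H)`.
* `integrable_sq_mul_mul_conj_of_bound` — the one-torus step (bound on the whole representative);
* `innerHDefined_of_bound` — (DEF-H) at one pair `α₁ = α₂ = α` from measurability + a bound of `D_H·α` on each (finite-mass) representative;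
* `defH_of_boundH` — the socket text from whole-representative bounds (no compactness);
* `defH_of_hcBoundedH` — THE SLICE: the socket text token for token from (M1H) + compact finite-mass representatives + HC-B on `H` in compact-set shape.

## References
* [Rogawski1990] J. D. Rogawski, *Automorphic Representations of Unitary Groups in Three Variables*, Ann. of Math. Stud. 123 (1990): §1.6 p. 5 ([H₁]: «`D_G χ_π` is locally
  bounded», due to Harish-Chandra); §4.9 p. 55 (`D_H`); §12.5 p. 184 (`⟨ , ⟩_{H,e}`, elliptic Cartan representatives, `meas(Z∖T) = 1`), Prop. 12.5.2 p. 184.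
* [HarishChandra1999AdmissibleDistributions] Harish-Chandra, *Admissible invariant distributions on reductive p-adic groups* (notes by S. DeBacker, P. J. Sally),
  AMS ULS 16 (1999): Part III §16 Thm. 16.3.
-/

set_option autoImplicit false
-- the mandated namespace has the single-problem summit's repeated segment (`HodgeConjecture.HodgeConjecture`)
set_option linter.dupNamespace false

noncomputable section

open MeasureTheory Filter Topology
open Literature.NumberTheory.Automorphic Literature.NumberTheory.Rogawski1990

namespace Summit.HodgeConjecture.HodgeConjecture.Cruxes.H413.F0P3cStCharTSDefHGlue

/-! ## §1 One torus: a bound for `D·α` on a subgroup of finite mass makes `D²·α·ᾱ` integrable -/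

/-- **One-torus step.**  `T ≤ H` a subgroup with a FINITE measure `μ` on `↥T`; `D : H → ℝ` and `α : H → ℂ` measurable; a bound `‖D(γ)·α(γ)‖ ≤ B` for `γ ∈ T`.  Then
`t ↦ D(t)²·α(t)·\overline{α(t)}` — the integrand of `⟨α, α⟩_{H,e}` on `T` [§12.5 p. 184] — is `μ`-integrable: its norm is `‖D·α‖² ≤ B²` (Mathlib `Integrable.mono'` against
the constant `B²`). [cite: Rogawski1990, §12.5 p. 184; §1.6 p. 5] -/
theorem integrable_sq_mul_mul_conj_of_bound
    {H : Type} [Group H] [MeasurableSpace H]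
    (T : Subgroup H) (μ : Measure ↥T) [IsFiniteMeasure μ]
    {D : H → ℝ} (hDm : Measurable D) {α : H → ℂ} (hαm : Measurable α) {B : ℝ}
    (hB : ∀ γ ∈ (T : Set H), ‖(D γ : ℂ) * α γ‖ ≤ B) :
    Integrable (fun t : ↥T => (D (t : H) : ℂ) ^ 2 * α (t : H) * starRingEnd ℂ (α (t : H))) μ := by
  refine Integrable.mono' (integrable_const (B ^ 2)) ?_ (Eventually.of_forall fun t => ?_)
  · exact ((((Complex.measurable_ofReal.comp (hDm.comp measurable_subtype_coe)).pow_const 2).mul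
      (hαm.comp measurable_subtype_coe)).mul
        (Complex.continuous_conj.measurable.comp (hαm.comp measurable_subtype_coe))).aestronglyMeasurable
  · have h := hB (t : H) (SetLike.mem_coe.2 t.2)
    have h0 : 0 ≤ ‖(D (t : H) : ℂ) * α (t : H)‖ := norm_nonneg _
    calc ‖(D (t : H) : ℂ) ^ 2 * α (t : H) * starRingEnd ℂ (α (t : H))‖
        = ‖(D (t : H) : ℂ) * α (t : H)‖ ^ 2 := by
          rw [norm_mul, norm_mul, norm_pow, RCLike.norm_conj, norm_mul]
          ring
      _ ≤ B ^ 2 := pow_le_pow_left₀ h0 h 2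

/-! ## §2 The slice: (DEF-H) at a datum with compact elliptic `H`-representatives of finite mass, from (M1H) + a Harish-Chandra bound on `H` -/

variable {G H : Type} [Group G] [TopologicalSpace G] [IsTopologicalGroup G] [MeasurableSpace G]
  [∀ γ : G, MeasurableSpace (G ⧸ Subgroup.centralizer ({γ} : Set G))] [MeasurableSpace (G ⧸ Subgroup.center G)]
  [Group H] [TopologicalSpace H] [IsTopologicalGroup H] [MeasurableSpace H]

/-- **(DEF-H) at one class function.**  For a §12.5 datum `𝔇` with `𝔇.DH` measurable and every `𝔇.μTH T`, `T ∈ 𝔇.cartanH`, finite: a measurable `α : H → ℂ` with a bound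
`‖D_H(γ)·α(γ)‖ ≤ B_T` on each representative `T ∈ 𝔇.cartanH` has ★ `𝔇.InnerHDefined α α` («the integrals defining `⟨α, α⟩_{H,e}` exist», p. 184).
[cite: Rogawski1990, §12.5 p. 184] -/
theorem innerHDefined_of_bound (𝔇 : Ch12Sec5.EllipticData G H)
    (hDHm : Measurable 𝔇.DH) (hFH : ∀ T ∈ 𝔇.cartanH, IsFiniteMeasure (𝔇.μTH T))
    {α : H → ℂ} (hαm : Measurable α)
    (hB : ∀ T ∈ 𝔇.cartanH, ∃ B : ℝ, ∀ γ ∈ (T : Set H), ‖(𝔇.DH γ : ℂ) * α γ‖ ≤ B) :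
    𝔇.InnerHDefined α α := by
  intro T hT
  haveI := hFH T hT
  obtain ⟨B, hBT⟩ := hB T hT
  exact integrable_sq_mul_mul_conj_of_bound T (𝔇.μTH T) hDHm hαm hBT

/-- **(DEF-H) from whole-representative bounds** (no compactness hypothesis): for a §12.5 datum `𝔇` with the (M1H) socket ★ `PacketCharHRegularity` (only its
measurability conjunct is read), `𝔇.DH` measurable, finite `𝔇.μTH T` on the representatives, and for every `ρ ∈ Π²(H)` and `T ∈ 𝔇.cartanH` a bound of `D_H·χ_ρ` on `T`:
the (S-𝔇) conjunct `∀ ρ ∈ 𝔇.sqPacketsH, 𝔇.InnerHDefined (𝔇.packetCharH ρ) (𝔇.packetCharH ρ)` (leaf ED. 17 text, token for token).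
[cite: Rogawski1990, §12.5 Prop. 12.5.2 p. 184; §1.6 p. 5] -/
theorem defH_of_boundH (𝔇 : Ch12Sec5.EllipticData G H)
    (hM1H : 𝔇.PacketCharHRegularity)
    (hDHm : Measurable 𝔇.DH) (hFH : ∀ T ∈ 𝔇.cartanH, IsFiniteMeasure (𝔇.μTH T))
    (hBH : ∀ ρ ∈ 𝔇.sqPacketsH, ∀ T ∈ 𝔇.cartanH, ∃ B : ℝ, ∀ γ ∈ (T : Set H), ‖(𝔇.DH γ : ℂ) * 𝔇.packetCharH ρ γ‖ ≤ B) :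
    ∀ ρ ∈ 𝔇.sqPacketsH, 𝔇.InnerHDefined (𝔇.packetCharH ρ) (𝔇.packetCharH ρ) :=
  fun ρ hρ => innerHDefined_of_bound 𝔇 hDHm hFH (hM1H ρ hρ).1 (hBH ρ hρ)

/-- **S12a «DEF-H GLUE★» — the socket (DEF-H) of the (S-𝔇) organ from (M1H) + compact finite-mass elliptic `H`-representatives + Harish-Chandra's bound on `H` in
compact-set shape.**  For every §12.5 datum `𝔇 : EllipticData G H` with: the (M1H) socket ★ `𝔇.PacketCharHRegularity` (the organ's own conjunct; only `Measurable (𝔇.packetCharH ρ)`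
is read); `𝔇.DH` measurable; every `T ∈ 𝔇.cartanH` COMPACT in `H` (PLAN S9 D3 on the `H` side: the elliptic Cartan subgroups of `H` are compact — the centre of `U(Φ₂) × U(Φ₁)`
is compact) with `𝔇.μTH T` FINITE (D4: print's `meas(Z∖T) = 1`, p. 184); and HC-B on `H`: for every `ρ ∈ Π²(H)`, `T ∈ 𝔇.cartanH` and compact `C ⊆ T` a bound
`‖D_H(γ)·χ_ρ(γ)‖ ≤ B` on `C` [§1.6 p. 5, Harish-Chandra Thm. 16.3 for `H`] — the conjunct `∀ ρ ∈ 𝔇.sqPacketsH, 𝔇.InnerHDefined (𝔇.packetCharH ρ) (𝔇.packetCharH ρ)` holds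
(leaf `F0_P3c_StCharTSPaydown.lean` ED. 17 text, token for token; the ED. pen can `exact` it in the (DEF-H) slot once the constructor supplies the four structure hypotheses).
[cite: Rogawski1990, §12.5 Prop. 12.5.2 p. 184; §1.6 p. 5] [cite: HarishChandra1999AdmissibleDistributions, Part III §16 Thm. 16.3] -/
theorem defH_of_hcBoundedH (𝔇 : Ch12Sec5.EllipticData G H)
    (hM1H : 𝔇.PacketCharHRegularity)
    (hDHm : Measurable 𝔇.DH)
    (hKH : ∀ T ∈ 𝔇.cartanH, IsCompact (T : Set H))
    (hFH : ∀ T ∈ 𝔇.cartanH, IsFiniteMeasure (𝔇.μTH T))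
    (hHBH : ∀ ρ ∈ 𝔇.sqPacketsH, ∀ T ∈ 𝔇.cartanH, ∀ C : Set H, IsCompact C → C ⊆ (T : Set H) →
      ∃ B : ℝ, ∀ γ ∈ C, ‖(𝔇.DH γ : ℂ) * 𝔇.packetCharH ρ γ‖ ≤ B) :
    ∀ ρ ∈ 𝔇.sqPacketsH, 𝔇.InnerHDefined (𝔇.packetCharH ρ) (𝔇.packetCharH ρ) :=
  defH_of_boundH 𝔇 hM1H hDHm hFH fun ρ hρ T hT => hHBH ρ hρ T hT (T : Set H) (hKH T hT) subset_rfl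

end Summit.HodgeConjecture.HodgeConjecture.Cruxes.H413.F0P3cStCharTSDefHGlue

end
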